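import Summits.Ventures.PercRepro0.Bubble
import Summits.Ventures.PercRepro0.BK

/-!
# R_MID-6 · INTEGRATED-BUBBLE with the BK hypothesis discharged (seat p4, block-M census supplement, part 3)

`Bubble.BK d` (module DisjOcc) is P10 · BK-INCREASING in the Finset-cylinder form; p2's module `BK` proves the
Set-cylinder form `BK.P_disjointOcc_le`. The two disjoint-occurrence events are nested
(`disjOcc_subset_disjointOcc`), so `BK_holds : ∀ d, Bubble.BK d`, and every statement of the module `Bubble`
is restated here with that hypothesis gone:

* `sum_P_piv_le'` (ii), `ofReal_tau_sub_le_lintegral'` (iii), `ofReal_theta_sq_le'` (iv), and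
* **`T_of_integrable_bubble'`** (v): for `d ≥ 1`, `∫_{p₀}^{p_c(d)} B_q dq < ∞` for some `p₀ ∈ [0, p_c(d))` ⇒ `T d`
  — R_MID-6 · INTEGRATED-BUBBLE kernel-checked on `Defs` with its ONE hypothesis explicit and no
  PUBLISHED-HELD input.

NOTHING here asserts the hypothesis for any `d`: the census (v6 §5 D3) puts the obstruction exactly there.
Census evidence only, off every declaration path; nothing claimed on `T(d)` for any `d`.
-/

namespace Summit.Ventures.PercRepro0.Bubble

open MeasureTheory unitInterval Set
open Summit.Ventures.PercRepro0.Defs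
open scoped ENNReal

variable {d : ℕ}

/-- The Finset-cylinder disjoint occurrence is contained in p2's Set-cylinder one. -/
theorem disjOcc_subset_disjointOcc (A B : Set (Config d)) :
    DisjOcc A B ⊆ Summit.Ventures.PercRepro0.BK.DisjointOcc A B := by
  rintro ω ⟨K, L, hKL, hK, hL⟩
  exact ⟨↑K, ↑L, Finset.disjoint_coe.2 hKL, fun ω' h => hK fun e he => h e (Finset.mem_coe.2 he),
    fun ω' h => hL fun e he => h e (Finset.mem_coe.2 he)⟩

/-- **P10 · BK holds** in the form `Bubble.BK d` (from `BK.P_disjointOcc_le`, seat p2). -/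
theorem BK_holds (d : ℕ) : BK d := fun p _E hE A B hA hB hdA hdB =>
  (measure_mono (disjOcc_subset_disjointOcc A B)).trans
    (Summit.Ventures.PercRepro0.BK.P_disjointOcc_le p hE hdA hdB hA hB)

/-- (ii) unconditional: `Σ_{e ∈ E(Λ_n)} P_p(e pivotal for {0 ↔_{Λ_n} x}) ≤ 2d · B_p`. -/
theorem sum_P_piv_le' (p : I) (n : ℕ) (x : Vertex d) :
    ∑ e ∈ Sharp.boxBondsF d n, P d p (Russo.Piv e (boxConn d n 0 x)) ≤ 2 * d * bubble d p :=
  sum_P_piv_le (BK_holds d) p n x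

/-- (iii) unconditional: `τ_b(0,x) − τ_a(0,x) ≤ 2d ∫_a^b B_q dq` for `0 ≤ a ≤ b ≤ 1`. -/
theorem ofReal_tau_sub_le_lintegral' (x : Vertex d) {a b : ℝ} (ha : 0 ≤ a) (hab : a ≤ b) (hb : b ≤ 1) :
    ENNReal.ofReal (tau d (clamp b) 0 x - tau d (clamp a) 0 x) ≤
      ∫⁻ q in Set.Ioc a b, 2 * d * bubble d (clamp q) :=
  ofReal_tau_sub_le_lintegral (BK_holds d) x ha hab hb

/-- (iv) unconditional (`d ≥ 1`): `θ_d(p_c(d))² ≤ 2d ∫_p^{p_c(d)} B_q dq` for `p ∈ [0, p_c(d))`. -/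
theorem ofReal_theta_sq_le' (hd : 1 ≤ d) {p : ℝ} (hp0 : 0 ≤ p) (hp : p < pc d) :
    ENNReal.ofReal (theta d (pc d) ^ 2) ≤ ∫⁻ q in Set.Ioc p (pc d), 2 * d * bubble d (clamp q) :=
  ofReal_theta_sq_le hd (BK_holds d) hp0 hp

/-- **(v) R_MID-6 · INTEGRATED-BUBBLE, unconditional** (`d ≥ 1`): if `∫_{p₀}^{p_c(d)} B_q dq < ∞` for some
`p₀ ∈ [0, p_c(d))`, then `θ_d(p_c(d)) = 0`. Nothing is asserted about the hypothesis for any `d`. -/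
theorem T_of_integrable_bubble' (hd : 1 ≤ d) {p₀ : ℝ} (hp₀ : 0 ≤ p₀) (hp₀c : p₀ < pc d)
    (hfin : ∫⁻ q in Set.Ioc p₀ (pc d), bubble d (clamp q) < ⊤) : T d :=
  T_of_integrable_bubble hd (BK_holds d) hp₀ hp₀c hfin

/-- The unconditional door in the paper's form (`p₀ ∈ (0, p_c(d))`). -/
theorem T_of_integrable_bubble_of_pos' (hd : 1 ≤ d) {p₀ : ℝ} (hp₀ : 0 < p₀) (hp₀c : p₀ < pc d)
    (hfin : ∫⁻ q in Set.Ioc p₀ (pc d), bubble d (clamp q) < ⊤) : T d :=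
  T_of_integrable_bubble' hd hp₀.le hp₀c hfin

end Summit.Ventures.PercRepro0.Bubble
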